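import Mathlib.Analysis.MellinInversion
import Mathlib.Analysis.Fourier.RiemannLebesgueLemma
import Literature.Analysis.Complex.LaplaceHalfLineInversion
import Literature.Analysis.FunctionSpaces.PlancherelL1L2
import HarnessLib

/-!
# The half-line Laplace transform along a vertical line is a Fourier transform: Riemann–Lebesgue and Plancherel on the line

Topic `Literature/Analysis/Complex`, continuation of `LaplaceHalfLine.lean` / `LaplaceHalfLineInversion.lean`. Everything here is PROVED; standard
(Schiff 1999 §4.1 (4.2) for the Fourier form of the Bromwich integrand; Titchmarsh, *Fourier Integrals*, Thm 1 (Riemann–Lebesgue) and Thm 48/71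
(Plancherel / Mellin–Parseval) for the two consequences).

For `g` continuous of exponential order `γ` (`HalfLineExpBound g G γ`) and `u > γ`:
* `laplaceC_vertical_eq_fourier` — `𝓛g(u + iy) = 𝓕 G_u (y/2π)` with `G_u(t) = e^{−ut}·𝟙_{t ≥ 0} g(t)` (`bromwichDensity`), an `L¹ ∩ L²` function;
* `tendsto_laplaceC_vertical_cocompact` — **Riemann–Lebesgue on the line**: `𝓛g(u + iy) → 0` as `|y| → ∞`; hence
  `exists_norm_laplaceC_vertical_le` — for every `ε > 0`, `‖𝓛g(u + iy)‖ ≤ ε` once `|y| ≥ Y₀`;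
* `integrable_norm_sq_laplaceC_vertical` — **Plancherel on the line**: `y ↦ ‖𝓛g(u + iy)‖²` is integrable (via the tree's
  `Literature.Analysis.FunctionSpaces.memLp_two_fourierIntegral`).

USE: these replace the one-integration-by-parts decay `O(1/|σ|)` of `LaplaceHalfLine.lean` when the kernel is merely continuous: on a vertical line the
square of the transform is integrable and the transform is eventually small, which is what the renewal-resolvent contour argument consumes on each line
(cell ns-blowup, renewal route (R-c′)). NOT here: uniformity of the Riemann–Lebesgue decay across a strip (needed for the horizontal sides), which is a
separate statement.
-/

noncomputable section

open _root_.Complex _root_.MeasureTheory _root_.Set _root_.Filter _root_.Real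
open scoped _root_.Topology FourierTransform

namespace Literature.Analysis.Complex

/-- The density on the line `Re s = u`: `G_u(t) = e^{−ut}·(𝟙_{[0,∞)} g)(t)`. [cite: Schiff1999, §4.1 (4.2)] -/
def bromwichDensity (g : ℝ → ℂ) (u : ℝ) (t : ℝ) : ℂ := Real.exp (-u * t) • Set.indicator (Ici 0) g t

/-- `bromwichDensity` is what Mathlib's `mellin_eq_fourier` produces from the pull-back of `g`. [cite: Schiff1999, §4.1 (4.2)] -/
theorem bromwichDensity_eq (g : ℝ → ℂ) (u : ℝ) :
    (fun t : ℝ => Real.exp (-u * t) • laplacePullback g (Real.exp (-t))) = bromwichDensity g u := by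
  funext t
  rw [bromwichDensity, laplacePullback_exp_neg]

/-- **The Bromwich integrand is a Fourier transform**: `𝓛g(u + iy) = 𝓕 (bromwichDensity g u) (y / 2π)`. [cite: Schiff1999, §4.1 (4.2)] -/
theorem laplaceC_vertical_eq_fourier (g : ℝ → ℂ) (u y : ℝ) :
    laplaceC g (u + y * I) = 𝓕 (bromwichDensity g u) (y / (2 * π)) := by
  rw [← mellin_laplacePullback, mellin_eq_fourier]
  have hre : ((u : ℂ) + (y : ℂ) * I).re = u := by simp
  have him : ((u : ℂ) + (y : ℂ) * I).im = y := by simp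
  rw [hre, him, bromwichDensity_eq]

/-- **Riemann–Lebesgue on a vertical line**: `𝓛g(u + iy) → 0` as `|y| → ∞` (any `u`; no growth hypothesis is needed — Mathlib's Riemann–Lebesgue lemma is stated for every function). [cite: Schiff1999, §4.2 (Riemann–Lebesgue lemma)] -/
theorem tendsto_laplaceC_vertical_cocompact (g : ℝ → ℂ) (u : ℝ) :
    Tendsto (fun y : ℝ => laplaceC g (u + y * I)) (cocompact ℝ) (𝓝 0) := by
  have h1 : Tendsto (𝓕 (bromwichDensity g u)) (cocompact ℝ) (𝓝 0) := Real.zero_at_infty_fourier _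
  have h2 : Tendsto (fun y : ℝ => y / (2 * π)) (cocompact ℝ) (cocompact ℝ) := by
    have : (fun y : ℝ => y / (2 * π)) = fun y => (2 * π)⁻¹ * y := by funext y; rw [div_eq_inv_mul]
    rw [this]
    exact Filter.tendsto_cocompact_mul_left₀ (inv_ne_zero (by positivity))
  have h3 := h1.comp h2
  refine h3.congr fun y => ?_
  simp only [Function.comp_apply, laplaceC_vertical_eq_fourier]

/-- **Eventual smallness on the line**: for `ε > 0` there is `Y₀ > 0` with `‖𝓛g(u + iy)‖ ≤ ε` for `|y| ≥ Y₀`.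
[cite: Schiff1999, §4.2 (Riemann–Lebesgue lemma)] -/
theorem exists_norm_laplaceC_vertical_le (g : ℝ → ℂ) (u : ℝ) {ε : ℝ} (hε : 0 < ε) :
    ∃ Y₀ : ℝ, 0 < Y₀ ∧ ∀ y : ℝ, Y₀ ≤ |y| → ‖laplaceC g (u + y * I)‖ ≤ ε := by
  have ht := tendsto_laplaceC_vertical_cocompact g u
  rw [cocompact_eq_atBot_atTop, tendsto_sup] at ht
  have hb := (ht.1.eventually (Metric.closedBall_mem_nhds (0 : ℂ) hε))
  have ha := (ht.2.eventually (Metric.closedBall_mem_nhds (0 : ℂ) hε))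
  rw [Filter.eventually_atBot] at hb
  rw [Filter.eventually_atTop] at ha
  obtain ⟨Y₁, hY₁⟩ := hb
  obtain ⟨Y₂, hY₂⟩ := ha
  refine ⟨max (max (-Y₁) Y₂) 1, by positivity, fun y hy => ?_⟩
  have hy1 : max (-Y₁) Y₂ ≤ |y| := le_trans (le_max_left _ _) hy
  rcases le_or_gt 0 y with hy0 | hy0
  · rw [abs_of_nonneg hy0] at hy1
    have := hY₂ y (le_trans (le_max_right _ _) hy1)
    rwa [dist_zero_right] at this
  · rw [abs_of_neg hy0] at hy1
    have := hY₁ y (by linarith [le_max_left (-Y₁) Y₂])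
    rwa [dist_zero_right] at this

namespace HalfLineExpBound

variable {g : ℝ → ℂ} {G γ : ℝ}

/-- Pointwise bound `‖G_u(t)‖ ≤ G e^{(γ − u)t}` on `t ≥ 0`, and `G_u(t) = 0` for `t < 0`. [cite: Schiff1999, Theorem 1.11 (proof)] -/
theorem norm_bromwichDensity_le (h : HalfLineExpBound g G γ) (u t : ℝ) :
    ‖bromwichDensity g u t‖ ≤ Set.indicator (Ici 0) (fun t => G * Real.exp ((γ - u) * t)) t := by
  rw [bromwichDensity]
  by_cases ht : t ∈ Ici (0 : ℝ)
  · rw [Set.indicator_of_mem ht, Set.indicator_of_mem ht, norm_smul, Real.norm_eq_abs, abs_of_pos (Real.exp_pos _)]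
    calc Real.exp (-u * t) * ‖g t‖ ≤ Real.exp (-u * t) * (G * Real.exp (γ * t)) :=
          mul_le_mul_of_nonneg_left (h.bound t ht) (Real.exp_pos _).le
      _ = G * Real.exp ((γ - u) * t) := by
          rw [show (γ - u) * t = -u * t + γ * t by ring, Real.exp_add]; ring
  · rw [Set.indicator_of_notMem ht, Set.indicator_of_notMem ht, smul_zero, norm_zero]

/-- `G_u` is a.e.-strongly measurable. [cite: Schiff1999, Theorem 1.11 (proof)] -/
theorem aestronglyMeasurable_bromwichDensity (h : HalfLineExpBound g G γ) (u : ℝ) :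
    AEStronglyMeasurable (bromwichDensity g u) volume := by
  have h1 : AEStronglyMeasurable (Set.indicator (Ici 0) g) volume :=
    h.continuous.aestronglyMeasurable.indicator measurableSet_Ici
  have h2 : Continuous fun t : ℝ => Real.exp (-u * t) := by fun_prop
  exact h2.aestronglyMeasurable.smul h1

/-- The dominating function `𝟙_{[0,∞)} G e^{(γ−u)t}` is integrable for `u > γ`. [cite: Schiff1999, Theorem 1.11 (proof)] -/
theorem integrable_dominator (h : HalfLineExpBound g G γ) {u : ℝ} (hu : γ < u) :
    Integrable (Set.indicator (Ici 0) (fun t : ℝ => G * Real.exp ((γ - u) * t))) := by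
  have := h.nonneg
  rw [integrable_indicator_iff measurableSet_Ici, integrableOn_Ici_iff_integrableOn_Ioi]
  exact (integrableOn_exp_mul_Ioi (by linarith) 0).const_mul G

/-- **`G_u ∈ L¹`** for `u > γ`. [cite: Schiff1999, Theorem 1.11] -/
theorem integrable_bromwichDensity (h : HalfLineExpBound g G γ) {u : ℝ} (hu : γ < u) : Integrable (bromwichDensity g u) :=
  Integrable.mono' (h.integrable_dominator hu) (h.aestronglyMeasurable_bromwichDensity u)
    (Eventually.of_forall fun t => h.norm_bromwichDensity_le u t)

/-- **`G_u ∈ L²`** for `u > γ`. [cite: Schiff1999, Theorem 1.11] -/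
theorem memLp_two_bromwichDensity (h : HalfLineExpBound g G γ) {u : ℝ} (hu : γ < u) : MemLp (bromwichDensity g u) 2 volume := by
  rw [memLp_two_iff_integrable_sq_norm (h.aestronglyMeasurable_bromwichDensity u)]
  have hdom : Integrable (Set.indicator (Ici 0) (fun t : ℝ => G ^ 2 * Real.exp ((2 * (γ - u)) * t))) := by
    rw [integrable_indicator_iff measurableSet_Ici, integrableOn_Ici_iff_integrableOn_Ioi]
    exact (integrableOn_exp_mul_Ioi (by linarith) 0).const_mul (G ^ 2)
  refine Integrable.mono' hdom ((h.aestronglyMeasurable_bromwichDensity u).norm.pow 2) (Eventually.of_forall fun t => ?_)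
  have hb := h.norm_bromwichDensity_le u t
  rw [Real.norm_eq_abs, abs_of_nonneg (sq_nonneg _)]
  by_cases ht : t ∈ Ici (0 : ℝ)
  · rw [Set.indicator_of_mem ht] at hb
    rw [Set.indicator_of_mem ht]
    have h0 : 0 ≤ ‖bromwichDensity g u t‖ := norm_nonneg _
    calc ‖bromwichDensity g u t‖ ^ 2 ≤ (G * Real.exp ((γ - u) * t)) ^ 2 := pow_le_pow_left₀ h0 hb 2
      _ = G ^ 2 * Real.exp ((2 * (γ - u)) * t) := by
          rw [mul_pow, ← Real.exp_nat_mul]; ring_nf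
  · rw [Set.indicator_of_notMem ht] at hb
    rw [Set.indicator_of_notMem ht]
    have : ‖bromwichDensity g u t‖ = 0 := le_antisymm hb (norm_nonneg _)
    rw [this]; norm_num

/-- **Plancherel on a vertical line**: `y ↦ ‖𝓛g(u + iy)‖²` is integrable (`u > γ`). [cite: Schiff1999, §4.1 (4.2) / Theorem 1.11] -/
theorem integrable_norm_sq_laplaceC_vertical (h : HalfLineExpBound g G γ) {u : ℝ} (hu : γ < u) :
    Integrable fun y : ℝ => ‖laplaceC g (u + y * I)‖ ^ 2 := by
  have hF : MemLp (𝓕 (bromwichDensity g u)) 2 (volume : Measure ℝ) :=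
    Literature.Analysis.FunctionSpaces.memLp_two_fourierIntegral (h.integrable_bromwichDensity hu) (h.memLp_two_bromwichDensity hu)
  have h2 : Integrable (fun ξ : ℝ => ‖𝓕 (bromwichDensity g u) ξ‖ ^ 2) := by
    have := (memLp_two_iff_integrable_sq_norm hF.1).1 hF
    exact this
  have h3 := h2.comp_div (show (2 * π : ℝ) ≠ 0 by positivity)
  refine h3.congr (Eventually.of_forall fun y => ?_)
  simp only [laplaceC_vertical_eq_fourier]

end HalfLineExpBound

end Literature.Analysis.Complex
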